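/-
Origin: expansion seat `prover-pub-hodgecm-own-htheta-g2-0`, handover #H33 2026-08-21T14:05:49Z md5 8e110f5e9848 (118 l.; NEW additive MODEL leaf — SCHAIN row 4 of 11: face-scope `_S`∕`_gal` twin of `HodgeCM/Model/E2InstanceOGR9.lean`-class head (scope triple ↦ `S c` ∕ `6 ≤ finrank ℚ c.K ∧ IsNormalClosure ℚ c.K L`); author item6-p2 (prover-pub-hodgecm2-item6-p2-0) under own-htheta; nothing cited beyond the record's binders; NOT an E term; sha256 933b5afe75d12ce1b099ad8e34321786f74008c0572cf7e2ded32e6f3f934024; CERT rc 0 + trio as in the header; NAMES for audit: HodgeCM.Model.thetaRealisation₂_picardCM_r9coreOG_S ) (`HOME/pub-hodgecm-own-htheta/stage81/HodgeCM/Model/E2InstanceOGR9S.lean`, md5 8e110f5e9848, 118 lines);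
landed by the p-seat packager p gen 32 (p-g32) in gate run 80 as `HodgeCM/Model/E2InstanceOGR9S.lean` (verbatim).
-/
/-
Copyright (c) 2026 the pub-hodgecm formalisation cell (harness21).  New file, not vendored.
Origin: seat `prover-pub-hodgecm2-item6-p2-0` (unit pub-hodgecm2-item6-p2, TRANSPOSITION item (vi) extra prover p2 queued behind the own-htheta
lineage; coordinator ruling 2026-08-21T13:01:49Z), 2026-08-21 — CLAIM pub-hodgecm STATUS 13:45:32Z «SCOPE-PARAMETRIC POINTWISE E-CHAIN `…_S`»
(hodge-director/ITEM6-SPLIT.md (vi-4); x2 `E-HEADS-FACE-BLUEPRINT.md` v1.1 fc085fc795dd §3 step (3)).  Target in PKG: `HodgeCM/Model/E2InstanceOGR9S.lean`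
(NEW additive leaf beside `HodgeCM/Model/E2InstanceOGR9.lean`, installed md5 c8665dcaa01a; imports `HodgeCM.Model.E2InstanceOGR9` + `HodgeCM.Model.E2InstanceOGR8S`; nothing of record imports it).
KERNEL ONLY: theorems, no proof holes, nothing cited, no `def`, no hypothesis kind of E; nothing here is a claim of the manuscripts under adjudication;
HC_CM is NOT proved.

WHAT IT IS — layer A6 (CORE at the theta-space pin) of the scope-parametric chain: the `_S` form of `perLCanonical_picardCM_r9coreOG`.  Statement = the original's VERBATIM except: (1) two new leading
binders `scope : ∀ {L}, SeesawCtx L → Prop` and `hscope : ∀ c, scope c → 6 ≤ finrank ℚ c.K`; (2) E's literal scope triple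
`Module.finrank ℚ c.K = 6 ∧ IsNormalClosure ℚ c.K L ∧ (… = 24 ∨ … = 48)` in every slot type ↦ `scope c`; (3) the regime proof terms
`two_lt_finrank_of_goodCtx … hc hK.1` / `isAnisotropic_of_goodCtx … hK.1` / `translOf … hK.1` ↦ x1's `_ge` forms (#H21 `Model/ThetaSpaceInputPinGe.lean`) at
`(hscope c hK)`; (4) the CONCLUSION `U.PerLCanonical` ↦ the POINTWISE one `∀ V c, GoodCtx ι₁ c → scope c → (mk ι₁).embedding = ι₁ →
Nonempty (U.ThetaRealisation₂ ι₁ V c.K c.Ψ c.σ)`; (5) the head call ↦ the `_S` predecessor.  Proof otherwise the original's.  E's layer is NOT re-derived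
from this one (E stays as installed); the two are siblings.  Generated from the installed bytes by `work/gen_schain.py` (edit list `work/gen_schain.report`).
-/
import Summits.HodgeConjecture.HodgeCM.Model.E2InstanceOGR9
import Summits.HodgeConjecture.HodgeCM.Model.E2InstanceOGR8S

/-! PORT of `HodgeCM/Model/E2InstanceOGR9S.lean` (HodgeCMPerL run 82) — verbatim mechanical port; provenance in the PORT header line. -/

set_option autoImplicit false

noncomputable section

open scoped TensorProduct InnerProductSpace Matrix

namespace HodgeCM

namespace Model

open HodgeCM.Universe (AdelicThetaCore AdelicThetaCore₀ SideData ThetaModel ModelAxiomsPerL)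
open Literature.AlgebraicGeometry.HodgeTheory
open Literature.AlgebraicGeometry.ComplexMultiplication (Shimura1998_Thm3_isogenousPower Shimura1998_Thm2_Cor)
open Literature.NumberTheory.Automorphic.PicardCM
open Literature.NumberTheory.Transcendental (Arapura2012_Cor_15_4_6)
open HodgeCM.CMTypeOps (inflate)
open HodgeCM.Model.SupplyResidual (ClassSupplyPackN)
open HodgeCM.Model.ThetaSpace

variable (hHD : exists_isReal_hodgeModel) (hI : hodgePQ_independent_of_hodgeModel)
  (h₁ : BallQuotientUniformised)  (h₃ : CMAbelianVarietyRealised)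

/-- `_S` (SCOPE-PARAMETRIC, POINTWISE-CONCLUSION) form of `perLCanonical_picardCM_r9coreOG`: E's scope triple ↦ a free class `scope c`, regime at `hscope`, conclusion = `ThetaRealisation₂` at every good context of the class. **ORIENTED-FAMILY twin of `perL_picardCM_r9core`** (`E2InstanceR9`): the recipe bit per complex place, `h ↦ hb L ι₁` in every binder;
proof = the source proof over the oriented predecessor. -/
theorem thetaRealisation₂_picardCM_r9coreOG_S (scope : ∀ {L : CMField}, SeesawCtx L → Prop) (hscope : ∀ {L : CMField} (c : SeesawCtx L), scope c → 6 ≤ Module.finrank ℚ c.K)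
    (hHR : BettiUniverse.HodgeRiemann20) (hb : ∀ L : CMField, (L →+* ℂ) → Bool)
    (hA : Arapura2012_Cor_15_4_6)
    (W : ∀ {L : CMField} {ι₁ : L →+* ℂ} (V : HermSpace3 L ι₁) (c : SeesawCtx L), WmInput V c.D)
    (S : ∀ {L : CMField} {ι₁ : L →+* ℂ} (V : HermSpace3 L ι₁) (c : SeesawCtx L), ThetaAdelicSide V c)
    (μ : ∀ {L : CMField}, SeesawCtx L → Fin 4 → NumberField.InfinitePlace L → ℤ)
    (hBetti : ∀ {L : CMField} {ι₁ : L →+* ℂ} (V : HermSpace3 L ι₁), EmbBettiSide hHD hI h₁ h₃ V)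
    (h31 : (picardCMUniverse hHD hI h₁ h₃).Fact_cmInflation)
    (hLiu : ∀ {L : CMField} {ι₁ : L →+* ℂ} (V : HermSpace3 L ι₁) (c : SeesawCtx L),
      (thetaModelOf hHD hI h₁ h₃ (hb L ι₁) (embOf hHD hI h₁ h₃) (coverOf hHD hI h₁ h₃ hA) (wmOfInput W) (thetaOf _ (thetaClassInputOf _ (fun V c => thetaSpaceInputOf hHD hI h₁ h₃ S V c))) (d12Of μ) (d34Of μ)).GoodCtx ι₁ c → scope c →
      (NumberField.InfinitePlace.mk ι₁).embedding = ι₁ →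
      ∀ (i : Fin 4) (Γ : Level V), ∃ (M : CMField) (k : c.K →+* M) (σ' : M →+* ℂ), σ'.comp k = c.σ ∧
        (thetaModelOf hHD hI h₁ h₃ (hb L ι₁) (embOf hHD hI h₁ h₃) (coverOf hHD hI h₁ h₃ hA) (wmOfInput W) (thetaOf _ (thetaClassInputOf _ (fun V c => thetaSpaceInputOf hHD hI h₁ h₃ S V c))) (d12Of μ) (d34Of μ)).Theta V c i Γ ⊆
          (picardCMUniverse hHD hI h₁ h₃).Uiso Γ M (inflate k (c.Ψ i)) σ')
    (thetaSat : ∀ {L : CMField} {ι₁ : L →+* ℂ} (V : HermSpace3 L ι₁) (c : SeesawCtx L)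
      (i : Fin 4) (Γ Γ' : Level V) (hle : Γ' ≤ Γ) (ω : (picardCMUniverse hHD hI h₁ h₃).CohC ((picardCMUniverse hHD hI h₁ h₃).pms L ι₁ V Γ) 1),
      ω ∈ (thetaModelOf hHD hI h₁ h₃ (hb L ι₁) (embOf hHD hI h₁ h₃) (coverOf hHD hI h₁ h₃ hA) (wmOfInput W) (thetaOf _ (thetaClassInputOf _ (fun V c => thetaSpaceInputOf hHD hI h₁ h₃ S V c))) (d12Of μ) (d34Of μ)).Theta V c i Γ →
        (picardCMUniverse hHD hI h₁ h₃).pullC (coverOf hHD hI h₁ h₃ hA Γ Γ' (Level.Γ_mono hle)) 1 ω ∈ (thetaModelOf hHD hI h₁ h₃ (hb L ι₁) (embOf hHD hI h₁ h₃) (coverOf hHD hI h₁ h₃ hA) (wmOfInput W) (thetaOf _ (thetaClassInputOf _ (fun V c => thetaSpaceInputOf hHD hI h₁ h₃ S V c))) (d12Of μ) (d34Of μ)).Theta V c i Γ')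
    (transl : ∀ {L : CMField} {ι₁ : L →+* ℂ} (V : HermSpace3 L ι₁) (c : SeesawCtx L)
      (hc : (thetaModelOf hHD hI h₁ h₃ (hb L ι₁) (embOf hHD hI h₁ h₃) (coverOf hHD hI h₁ h₃ hA) (wmOfInput W) (thetaOf _ (thetaClassInputOf _ (fun V c => thetaSpaceInputOf hHD hI h₁ h₃ S V c))) (d12Of μ) (d34Of μ)).GoodCtx ι₁ c) (hK : scope c),
      ∀ γ ∈ (ballOf hHD hI h₁ h₃ V c (two_lt_finrank_of_goodCtx_ge hHD hI h₁ h₃ hc (hscope c hK))).Δ, ∀ (i : Fin 4) (Γ : Level V) (ω : (picardCMUniverse hHD hI h₁ h₃).CohC ((picardCMUniverse hHD hI h₁ h₃).pms L ι₁ V Γ) 1),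
      ω ∈ (thetaModelOf hHD hI h₁ h₃ (hb L ι₁) (embOf hHD hI h₁ h₃) (coverOf hHD hI h₁ h₃ hA) (wmOfInput W) (thetaOf _ (thetaClassInputOf _ (fun V c => thetaSpaceInputOf hHD hI h₁ h₃ S V c))) (d12Of μ) (d34Of μ)).Theta V c i Γ → ∃ (Γ' : Level V) (ω' : (picardCMUniverse hHD hI h₁ h₃).CohC ((picardCMUniverse hHD hI h₁ h₃).pms L ι₁ V Γ') 1),
        ω' ∈ (thetaModelOf hHD hI h₁ h₃ (hb L ι₁) (embOf hHD hI h₁ h₃) (coverOf hHD hI h₁ h₃ hA) (wmOfInput W) (thetaOf _ (thetaClassInputOf _ (fun V c => thetaSpaceInputOf hHD hI h₁ h₃ S V c))) (d12Of μ) (d34Of μ)).Theta V c i Γ' ∧ (ballOf hHD hI h₁ h₃ V c (two_lt_finrank_of_goodCtx_ge hHD hI h₁ h₃ hc (hscope c hK))).ev Γ' ω' =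
          fun x => (ballOf hHD hI h₁ h₃ V c (two_lt_finrank_of_goodCtx_ge hHD hI h₁ h₃ hc (hscope c hK))).J γ x *ᵥ (ballOf hHD hI h₁ h₃ V c (two_lt_finrank_of_goodCtx_ge hHD hI h₁ h₃ hc (hscope c hK))).ev Γ ω (γ • x))
    (C : ∀ {L : CMField} {ι₁ : L →+* ℂ} (V : HermSpace3 L ι₁) (c : SeesawCtx L) (hV : IsAnisotropic L V.Hm),
      (thetaModelOf hHD hI h₁ h₃ (hb L ι₁) (embOf hHD hI h₁ h₃) (coverOf hHD hI h₁ h₃ hA) (wmOfInput W) (thetaOf _ (thetaClassInputOf _ (fun V c => thetaSpaceInputOf hHD hI h₁ h₃ S V c))) (d12Of μ) (d34Of μ)).GoodCtx ι₁ c →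
      scope c →
      (NumberField.InfinitePlace.mk ι₁).embedding = ι₁ → ∀ k : Fin 4, k = 0 ∨ k = 1 → ∀ N : ℕ, 0 < N →
        ArchKTypeData (thetaSpaceInputIn hHD hI h₁ h₃ (S V c) hV) k N)
    (hol : ∀ {L : CMField} {ι₁ : L →+* ℂ} (V : HermSpace3 L ι₁) (c : SeesawCtx L) (hV : IsAnisotropic L V.Hm)
      (hc : (thetaModelOf hHD hI h₁ h₃ (hb L ι₁) (embOf hHD hI h₁ h₃) (coverOf hHD hI h₁ h₃ hA) (wmOfInput W) (thetaOf _ (thetaClassInputOf _ (fun V c => thetaSpaceInputOf hHD hI h₁ h₃ S V c))) (d12Of μ) (d34Of μ)).GoodCtx ι₁ c)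
      (h6 : scope c) (hcan : (NumberField.InfinitePlace.mk ι₁).embedding = ι₁) (k : Fin 4) (hk : k = 0 ∨ k = 1) (N : ℕ) (hN : 0 < N),
      ∀ f ∈ ((thetaSpaceInputIn hHD hI h₁ h₃ (S V c) hV).P k).weightFunctions,
        (C V c hV hc h6 hcan k hk N hN).toProduct.restrictedThetaForm f ∈
          ((thetaSpaceInputIn hHD hI h₁ h₃ (S V c) hV).D (C V c hV hc h6 hcan k hk N hN).Γ₀).Hol)
    (gen12 : ∀ {L : CMField} {ι₁ : L →+* ℂ} (V : HermSpace3 L ι₁) (c : SeesawCtx L),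
      (thetaModelOf hHD hI h₁ h₃ (hb L ι₁) (embOf hHD hI h₁ h₃) (coverOf hHD hI h₁ h₃ hA) (wmOfInput W) (thetaOf _ (thetaClassInputOf _ (fun V c => thetaSpaceInputOf hHD hI h₁ h₃ S V c))) (d12Of μ) (d34Of μ)).GoodCtx ι₁ c → scope c →
      (NumberField.InfinitePlace.mk ι₁).embedding = ι₁ →
      Nonempty ((thetaModelOf hHD hI h₁ h₃ (hb L ι₁) (embOf hHD hI h₁ h₃) (coverOf hHD hI h₁ h₃ hA) (wmOfInput W) (thetaOf _ (thetaClassInputOf _ (fun V c => thetaSpaceInputOf hHD hI h₁ h₃ S V c))) (d12Of μ) (d34Of μ)).Gen12FunBridge V c))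
    (real34 : ∀ {L : CMField} {ι₁ : L →+* ℂ} (V : HermSpace3 L ι₁) (c : SeesawCtx L),
      (thetaModelOf hHD hI h₁ h₃ (hb L ι₁) (embOf hHD hI h₁ h₃) (coverOf hHD hI h₁ h₃ hA) (wmOfInput W) (thetaOf _ (thetaClassInputOf _ (fun V c => thetaSpaceInputOf hHD hI h₁ h₃ S V c))) (d12Of μ) (d34Of μ)).GoodCtx ι₁ c → scope c →
      (NumberField.InfinitePlace.mk ι₁).embedding = ι₁ →
      Nonempty ((thetaModelOf hHD hI h₁ h₃ (hb L ι₁) (embOf hHD hI h₁ h₃) (coverOf hHD hI h₁ h₃ hA) (wmOfInput W) (thetaOf _ (thetaClassInputOf _ (fun V c => thetaSpaceInputOf hHD hI h₁ h₃ S V c))) (d12Of μ) (d34Of μ)).Real34FunBridge V c))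
    (hyp12 : ∀ {L : CMField} {ι₁ : L →+* ℂ} (V : HermSpace3 L ι₁) (c : SeesawCtx L),
      (thetaModelOf hHD hI h₁ h₃ (hb L ι₁) (embOf hHD hI h₁ h₃) (coverOf hHD hI h₁ h₃ hA) (wmOfInput W) (thetaOf _ (thetaClassInputOf _ (fun V c => thetaSpaceInputOf hHD hI h₁ h₃ S V c))) (d12Of μ) (d34Of μ)).GoodCtx ι₁ c → scope c →
      (NumberField.InfinitePlace.mk ι₁).embedding = ι₁ →
      Nonempty (((coreOf _ (embOf hHD hI h₁ h₃) (coverOf hHD hI h₁ h₃ hA) (wmOfInput W) (thetaOf _ (thetaClassInputOf _ (fun V c => thetaSpaceInputOf hHD hI h₁ h₃ S V c)))).toCore (hb L ι₁)).HypSmoothCore12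
        (((coreOf _ (embOf hHD hI h₁ h₃) (coverOf hHD hI h₁ h₃ hA) (wmOfInput W) (thetaOf _ (thetaClassInputOf _ (fun V c => thetaSpaceInputOf hHD hI h₁ h₃ S V c)))).toCore (hb L ι₁)).side12 (d12Of μ)) (((coreOf _ (embOf hHD hI h₁ h₃) (coverOf hHD hI h₁ h₃ hA) (wmOfInput W) (thetaOf _ (thetaClassInputOf _ (fun V c => thetaSpaceInputOf hHD hI h₁ h₃ S V c)))).toCore (hb L ι₁)).side34 (d34Of μ))
        ((((coreOf _ (embOf hHD hI h₁ h₃) (coverOf hHD hI h₁ h₃ hA) (wmOfInput W) (thetaOf _ (thetaClassInputOf _ (fun V c => thetaSpaceInputOf hHD hI h₁ h₃ S V c)))).toCore (hb L ι₁)).analyticKM (((coreOf _ (embOf hHD hI h₁ h₃) (coverOf hHD hI h₁ h₃ hA) (wmOfInput W) (thetaOf _ (thetaClassInputOf _ (fun V c => thetaSpaceInputOf hHD hI h₁ h₃ S V c)))).toCore (hb L ι₁)).side12 (d12Of μ))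
          (((coreOf _ (embOf hHD hI h₁ h₃) (coverOf hHD hI h₁ h₃ hA) (wmOfInput W) (thetaOf _ (thetaClassInputOf _ (fun V c => thetaSpaceInputOf hHD hI h₁ h₃ S V c)))).toCore (hb L ι₁)).side34 (d34Of μ))).toAnalytic) V c (ℓ := linOfInput W V c)))
    (hyp34 : ∀ {L : CMField} {ι₁ : L →+* ℂ} (V : HermSpace3 L ι₁) (c : SeesawCtx L),
      (thetaModelOf hHD hI h₁ h₃ (hb L ι₁) (embOf hHD hI h₁ h₃) (coverOf hHD hI h₁ h₃ hA) (wmOfInput W) (thetaOf _ (thetaClassInputOf _ (fun V c => thetaSpaceInputOf hHD hI h₁ h₃ S V c))) (d12Of μ) (d34Of μ)).GoodCtx ι₁ c → scope c →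
      (NumberField.InfinitePlace.mk ι₁).embedding = ι₁ →
      Nonempty (((coreOf _ (embOf hHD hI h₁ h₃) (coverOf hHD hI h₁ h₃ hA) (wmOfInput W) (thetaOf _ (thetaClassInputOf _ (fun V c => thetaSpaceInputOf hHD hI h₁ h₃ S V c)))).toCore (hb L ι₁)).HypSmoothCore34
        (((coreOf _ (embOf hHD hI h₁ h₃) (coverOf hHD hI h₁ h₃ hA) (wmOfInput W) (thetaOf _ (thetaClassInputOf _ (fun V c => thetaSpaceInputOf hHD hI h₁ h₃ S V c)))).toCore (hb L ι₁)).side12 (d12Of μ)) (((coreOf _ (embOf hHD hI h₁ h₃) (coverOf hHD hI h₁ h₃ hA) (wmOfInput W) (thetaOf _ (thetaClassInputOf _ (fun V c => thetaSpaceInputOf hHD hI h₁ h₃ S V c)))).toCore (hb L ι₁)).side34 (d34Of μ))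
        ((((coreOf _ (embOf hHD hI h₁ h₃) (coverOf hHD hI h₁ h₃ hA) (wmOfInput W) (thetaOf _ (thetaClassInputOf _ (fun V c => thetaSpaceInputOf hHD hI h₁ h₃ S V c)))).toCore (hb L ι₁)).analyticKM (((coreOf _ (embOf hHD hI h₁ h₃) (coverOf hHD hI h₁ h₃ hA) (wmOfInput W) (thetaOf _ (thetaClassInputOf _ (fun V c => thetaSpaceInputOf hHD hI h₁ h₃ S V c)))).toCore (hb L ι₁)).side12 (d12Of μ))
          (((coreOf _ (embOf hHD hI h₁ h₃) (coverOf hHD hI h₁ h₃ hA) (wmOfInput W) (thetaOf _ (thetaClassInputOf _ (fun V c => thetaSpaceInputOf hHD hI h₁ h₃ S V c)))).toCore (hb L ι₁)).side34 (d34Of μ))).toAnalytic) V c (ℓ := linOfInput W V c))) :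
    ∀ {L : CMField} {ι₁ : L →+* ℂ} (V : HermSpace3 L ι₁) (c : SeesawCtx L),
      (thetaModelOf hHD hI h₁ h₃ (hb L ι₁) (embOf hHD hI h₁ h₃) (coverOf hHD hI h₁ h₃ hA) (wmOfInput W) (thetaOf _ (thetaClassInputOf _ (fun V c => thetaSpaceInputOf hHD hI h₁ h₃ S V c))) (d12Of μ) (d34Of μ)).GoodCtx ι₁ c → scope c →
      (NumberField.InfinitePlace.mk ι₁).embedding = ι₁ →
      Nonempty ((picardCMUniverse hHD hI h₁ h₃).ThetaRealisation₂ ι₁ V c.K c.Ψ c.σ) :=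
  thetaRealisation₂_picardCM_r8coreOG_S hHD hI h₁ h₃ scope hscope hHR hb hA W (fun {L} {ι₁} V c => thetaSpaceInputOf hHD hI h₁ h₃ S V c) μ hBetti h31
    hLiu thetaSat transl
    (fun {L} {ι₁} V c hc h6 hcan k hk N hN => Classical.choice (by
      have hV := isAnisotropic_of_goodCtx_ge V hc (hscope c h6)
      show Nonempty (SupplySituationAt (thetaSpaceInputOf hHD hI h₁ h₃ S V c) k N)
      rw [thetaSpaceInputOf_of_isAnisotropic hHD hI h₁ h₃ S V c hV]
      exact ⟨(C V c hV hc h6 hcan k hk N hN).toSupplySituationAt (hol V c hV hc h6 hcan k hk N hN)⟩))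
    gen12 real34 hyp12 hyp34

end Model
end HodgeCM

end
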